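import Literature.Analysis.FluidPDE.HeatDuhamelEnergy
import Literature.Analysis.FluidPDE.EnergyToolkit
import Literature.Analysis.FluidPDE.NSGaldiDualityIdentity
import Literature.Analysis.FluidPDE.NSWeakStrongUniquenessProofs
import HarnessLib

/-!
# Quantitative bounds from the vorticity-duality identity

Analysis/FluidPDE support file in the discharge programme of the named fact
`Literature.Analysis.FluidPDE.galdi_energy_equality` (Galdi 2019, Proc. AMS 147, Thm. 1.1), layer
`Literature.Analysis.FluidPDE.galdi_lerayHopf_class`: a distributional solution `v ∈ L⁴(0,T; L⁴)`
of the unforced Navier–Stokes system with datum `v₀ ∈ L²_σ` lies in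
`L^∞(0,T; L²) ∩ L²(0,T; H¹)`. The vorticity-duality identity of
`Literature/Analysis/FluidPDE/NSGaldiDualityIdentity` expresses the pairing of `v` with a
curl-type test field `Φ = (∂ₐθ) c - (∂_cθ) a` through `∫⟪v, (v·∇)U⟫ + ∫⟪v₀, U(0)⟫`,
`U = 𝒰[Φ]` the backward caloric Duhamel integral. This file turns the identity into the two
estimates that drive the class assertion:

* `Literature.Analysis.FluidPDE.IsWeakNSSolutionOn.abs_integral_inner_curlPair_le_L1`
  (**`L¹ₜL²ₓ` bound**, towards `v ∈ L^∞(0,T; L²)`):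
  `|∫_{(0,T)×E} ⟪v, Φ⟫| ≤ (√(2/ν) ‖v‖²_{L⁴(Q_T)} + 2‖v₀‖₂) ∫₀ᵀ ‖Φ(s)‖₂ ds`
  (also in the abstract form `abs_integral_inner_le_L1_of_duality`, for any `E`-valued test
  data `Φ` for which the duality identity holds — it is linear in `Φ`);
* `Literature.Analysis.FluidPDE.IsWeakNSSolutionOn.abs_integral_inner_curlPair_le_L2`
  (**`L²(Q_T)` bound**, towards `∇v ∈ L²(Q_T)` through the vorticity):
  `|∫_{(0,T)×E} ⟪v, Φ⟫| ≤ 2‖a‖‖c‖ ((√n/ν) ‖v‖²_{L⁴(Q_T)} + √(2n/ν) ‖v₀‖₂) ‖θ‖_{L²(Q_T)}`,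
  `n = dim E`.

Both rest on `|∫⟪v, (v·∇)U⟫| ≤ ‖v‖²_{L⁴(Q_T)} ‖∇U‖_{L²(Q_T)}`
(`abs_integral_inner_clm_apply_le`) and `|∫⟪v₀, U(0)⟫| ≤ ‖v₀‖₂ ‖U(0)‖₂`, combined with energy
estimates for the backward Duhamel integral: for the first, the **`L¹ₜL²ₓ` energy estimate**
`sup_{[0,T]} ‖U‖₂ ≤ 2N`, `ν‖∇U‖²_{L²(Q_T)} ≤ 2N²`, `N = ∫₀ᵀ ‖Φ(s)‖₂ ds`
(`IsSpaceTimeTestOn.energy_estimate_L1`, proved here from the first energy identity of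
`HeatDuhamelEnergy` by the self-improving bound `S² ≤ 2SN` on `S = sup ‖U‖₂`); for the second,
the tree's maximal regularity `‖D²𝒰[θ]‖²_{L²(Q_T)} ≤ (n/ν²)‖θ‖²_{L²(Q_T)}`
(`IsSpaceTimeTestOn.energy_estimate_one`) and the initial-gradient bound
`‖D𝒰[θ](0)‖₂² ≤ (2n/ν) ‖θ‖²_{L²(Q_T)}`
(`IsSpaceTimeTestOn.sum_integral_sq_norm_fderiv_heatDuhamelBack_zero_le`, from the second
energy identity), via `‖∇U‖ ≤ 2‖a‖‖c‖ ‖D²𝒰[θ]‖`, `‖U(0)‖ ≤ 2‖a‖‖c‖ ‖D𝒰[θ](0)‖`.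

Supporting lemmas (all proved): operator norms through frame sums (`opNorm_le_sqrt_sum_sq`,
`norm_fderiv_fderiv_sq_le_sum_sum`), the passage between the two slab measures
`(vol|_(0,T)) × vol` on `ℝ × E` and `vol × (vol|_(0,T])` on `E × ℝ` (`integral_slab_swap`), frame
sums of first/second derivatives of Duhamel fields on the slab. No new definitions.

## Mathlib / tree search

Mathlib: conditionally complete lattice API on `ℝ` (`le_csSup`, `csSup_le`),
`Finset.sum_mul_sq_le_sq_mul_sq`, `OrthonormalBasis.sum_sq_norm_inner_right`,
`integral_prod_swap`, `restrict_Ioo_eq_restrict_Ioc`. From the tree: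
`HeatDuhamelEnergy` (`energy_identity_zero/one`, `energy_estimate_zero/one`,
`integral_abs_inner_le_sqrt_mul_sqrt`, `norm_laplacian_sq_le`, product integrability of
Duhamel fields), `EnergyToolkit` (`integral_norm_mul_norm_le_sqrt_mul_sqrt`),
`NSGaldiExtendedTest`, `NSGaldiDualityIdentity`.

## References

* G. P. Galdi, *On the energy equality for distributional solutions to Navier–Stokes equations*,
  Proc. Amer. Math. Soc. 147 (2019), 785–792 (arXiv:1710.05725), proof of Thm. 1.1,
  (2.12)–(2.15) and (2.3) (the uniform energy bound of the adjoint solutions). Bib key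
  `Galdi2018`.
* P. G. Lemarié-Rieusset, *The Navier–Stokes problem in the 21st century*, CRC Press 2016,
  Prop. 4.3 (B), (C), pp. 74–75. Bib key `LemarieRieusset2016`.
-/

noncomputable section

open MeasureTheory TopologicalSpace Set Function Filter Topology InnerProductSpace Metric
open scoped RealInnerProductSpace ENNReal NNReal ContDiff Laplacian

namespace Literature.Analysis.FluidPDE

variable {E : Type*} [NormedAddCommGroup E] [InnerProductSpace ℝ E] [FiniteDimensional ℝ E]
  [MeasurableSpace E] [BorelSpace E]
variable {F : Type*} [NormedAddCommGroup F] [InnerProductSpace ℝ F] [CompleteSpace F]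

/-- Local notation (as in `NSGaldiExtendedTest`): the linear map `ℓ ↦ ℓ a • c - ℓ c • a`. -/
local notation3 "𝐋[" a ", " c "]" =>
  ((ContinuousLinearMap.apply ℝ ℝ a).smulRight c - (ContinuousLinearMap.apply ℝ ℝ c).smulRight a :
    (E →L[ℝ] ℝ) →L[ℝ] E)

/-! ### The `L¹ₜ L²ₓ` energy estimate for the backward Duhamel integral -/

section EnergyL1

variable {ν : ℝ} {Θ : ℝ → E → F}

omit [CompleteSpace F] in
/-- The `L²` norms of the slices of a space–time test field depend continuously on time. [folklore] -/
theorem IsSpaceTimeTestOn.continuous_integral_sq_norm_slice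
    (hΘ : IsSpaceTimeTestOn (⊤ : Opens (ℝ × E)) Θ) :
    Continuous fun s => ∫ x, ‖Θ s x‖ ^ 2 := by
  set K : Set E := Prod.snd '' tsupport (uncurry Θ) with hK_def
  have hK : IsCompact K := hΘ.hasCompactSupport.image continuous_snd
  have hΘK : ∀ t x, x ∉ K → Θ t x = 0 := fun t x hx => by
    by_contra h
    exact hx ⟨(t, x), subset_tsupport _ h, rfl⟩
  have hc : ContinuousOn (uncurry fun s x => ‖Θ s x‖ ^ 2) (univ ×ˢ univ) :=
    ((continuous_norm.comp hΘ.contDiff.continuous).pow 2).continuousOn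
  have h := continuousOn_integral_of_support_subset (μ := (volume : Measure E)) (S := univ) hK hc
    (fun t _ x hx => by simp [hΘK t x hx])
  rwa [continuousOn_univ] at h

/-- **The `L¹ₜ L²ₓ` energy estimate** (Lemarié-Rieusset 2016, Prop. 4.3 (B), `L¹ₜ` variant,
time-reversed). For `U = 𝒰[Θ]`, `Θ` a space–time test field supported in time in `[a, b]`,
`0 ≤ T`, `b ≤ T`, and `N = ∫₀ᵀ ‖Θ(s)‖_{L²} ds`:
`sup_{τ ∈ [0,T]} ‖U(τ)‖_{L²} ≤ 2N` and `ν ∫₀ᵀ Σᵢ ‖∂ᵢU(s)‖₂² ds ≤ 2N²`.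
Proof: the first energy identity `‖U(τ)‖₂² + 2ν∫_τ^T Σᵢ‖∂ᵢU‖₂² = 2∫_τ^T ⟨U, Θ⟩ ≤ 2 S N` with
`S = sup_{[0,T]} ‖U‖₂` (Cauchy–Schwarz in `x`), whence `S² ≤ 2SN`, `S ≤ 2N`. [cite: LemarieRieusset2016, Prop. 4.3 (B), p. 74] -/
theorem IsSpaceTimeTestOn.energy_estimate_L1
    (hΘ : IsSpaceTimeTestOn (⊤ : Opens (ℝ × E)) Θ) (hν : 0 < ν) {a b : ℝ}
    (hab : ∀ t, t ∉ Icc a b → Θ t = 0) {T : ℝ} (hT : 0 ≤ T) (hbT : b ≤ T) :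
    (∀ τ ∈ Icc 0 T, Real.sqrt (∫ x, ‖heatDuhamelBack ν Θ τ x‖ ^ 2) ≤
        2 * ∫ s in (0 : ℝ)..T, Real.sqrt (∫ x, ‖Θ s x‖ ^ 2)) ∧
      ν * ∫ s in (0 : ℝ)..T, ∑ i, ∫ x, ‖fderiv ℝ (heatDuhamelBack ν Θ s) x
          (stdOrthonormalBasis ℝ E i)‖ ^ 2 ≤
        2 * (∫ s in (0 : ℝ)..T, Real.sqrt (∫ x, ‖Θ s x‖ ^ 2)) ^ 2 := by
  set bE := stdOrthonormalBasis ℝ E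
  set U : ℝ → E → F := heatDuhamelBack ν Θ with hU
  set g : ℝ → ℝ := fun s => Real.sqrt (∫ x, ‖U s x‖ ^ 2) with hg
  set φ : ℝ → ℝ := fun s => Real.sqrt (∫ x, ‖Θ s x‖ ^ 2) with hφ
  set N : ℝ := ∫ s in (0 : ℝ)..T, φ s with hN
  set D : ℝ → ℝ := fun τ => ∫ s in τ..T, ∑ i, ∫ x, ‖fderiv ℝ (U s) x (bE i)‖ ^ 2 with hD
  have hφc : Continuous φ := Real.continuous_sqrt.comp hΘ.continuous_integral_sq_norm_slice
  have hφ0 : ∀ s, 0 ≤ φ s := fun s => Real.sqrt_nonneg _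
  have hg0 : ∀ s, 0 ≤ g s := fun s => Real.sqrt_nonneg _
  have hN0 : 0 ≤ N := intervalIntegral.integral_nonneg hT fun s _ => hφ0 s
  have hE0 : ∀ τ, 0 ≤ ∫ x, ‖U τ x‖ ^ 2 := fun τ => integral_nonneg fun _ => by positivity
  have hD0 : ∀ τ, τ ≤ T → 0 ≤ D τ := fun τ hτ =>
    intervalIntegral.integral_nonneg hτ fun s _ => Finset.sum_nonneg fun i _ =>
      integral_nonneg fun _ => by positivity
  -- Cauchy–Schwarz on the slices: `∫⟪U, Θ⟫ ≤ g φ`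
  have hΘ2 : ∀ s, MemLp (Θ s) 2 (volume : Measure E) := fun s =>
    (hΘ.contDiff_slice s).continuous.memLp_of_hasCompactSupport (hΘ.hasCompactSupport_slice s)
  have hCS : ∀ s, ∫ x, ⟪U s x, Θ s x⟫ ≤ g s * φ s := fun s => by
    have h := integral_abs_inner_le_sqrt_mul_sqrt (hΘ.memLp_two_heatDuhamelBack hν s) (hΘ2 s)
    have h' : ∫ x, ⟪U s x, Θ s x⟫ ≤ ∫ x, |⟪U s x, Θ s x⟫| :=
      (le_abs_self _).trans abs_integral_le_integral_abs
    refine h'.trans (h.trans (le_of_eq ?_))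
    simp only [hg, hφ, hU, Real.sqrt_eq_rpow]
  -- the supremum `S` of `g` on `[0, T]`
  set Q : ℝ := ∫ s in (0 : ℝ)..T, ∫ x, ‖Θ s x‖ ^ 2 with hQ
  have hbdd : BddAbove (g '' Icc 0 T) := by
    refine ⟨Real.sqrt (4 * (T - 0) * Q), ?_⟩
    rintro _ ⟨τ, hτ, rfl⟩
    exact Real.sqrt_le_sqrt ((hΘ.energy_estimate_zero hν hab hT hbT).1 τ hτ)
  have hne : (g '' Icc 0 T).Nonempty := ⟨g 0, 0, ⟨le_rfl, hT⟩, rfl⟩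
  set S : ℝ := sSup (g '' Icc 0 T) with hS
  have hgS : ∀ τ ∈ Icc 0 T, g τ ≤ S := fun τ hτ => le_csSup hbdd ⟨τ, hτ, rfl⟩
  have hS0 : 0 ≤ S := (hg0 0).trans (hgS 0 ⟨le_rfl, hT⟩)
  -- the pairing integral `I(τ) = ∫_τ^T ⟨U, Θ⟩ ≤ S N`
  have hI : ∀ τ ∈ Icc 0 T, ∫ s in τ..T, ∫ x, ⟪U s x, Θ s x⟫ ≤ S * N := by
    intro τ hτ
    have hτT : τ ≤ T := hτ.2
    have ip : IntegrableOn (fun s => ∫ x, ⟪U s x, Θ s x⟫) (Ioc τ T) volume :=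
      (hΘ.integrable_prod_inner_heatDuhamelBack_test hΘ hν τ T).integral_prod_right
    have iφ : IntegrableOn (fun s => S * φ s) (Ioc τ T) volume :=
      (hφc.integrableOn_Icc.mono_set Ioc_subset_Icc_self).const_mul S
    rw [intervalIntegral.integral_of_le hτT]
    calc ∫ s in Ioc τ T, ∫ x, ⟪U s x, Θ s x⟫ ≤ ∫ s in Ioc τ T, S * φ s := by
          refine setIntegral_mono_on ip iφ measurableSet_Ioc fun s hs => ?_
          refine (hCS s).trans (mul_le_mul_of_nonneg_right (hgS s ⟨hτ.1.trans hs.1.le, hs.2⟩) (hφ0 s))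
      _ = S * ∫ s in Ioc τ T, φ s := integral_const_mul _ _
      _ ≤ S * N := by
          refine mul_le_mul_of_nonneg_left ?_ hS0
          rw [hN, intervalIntegral.integral_of_le hT]
          exact setIntegral_mono_set (hφc.integrableOn_Icc.mono_set Ioc_subset_Icc_self)
            (Eventually.of_forall fun s => hφ0 s) (Ioc_subset_Ioc hτ.1 le_rfl).eventuallyLE
  -- `g(τ)² ≤ 2 S N` on `[0, T]`, hence `S² ≤ 2 S N` and `S ≤ 2N`
  have hid : ∀ τ ∈ Icc 0 T, (∫ x, ‖U τ x‖ ^ 2) + 2 * ν * D τ =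
      2 * ∫ s in τ..T, ∫ x, ⟪U s x, Θ s x⟫ := fun τ hτ =>
    hΘ.energy_identity_zero hν hab hτ.2 hbT
  have hg2 : ∀ τ ∈ Icc 0 T, g τ ^ 2 ≤ 2 * S * N := fun τ hτ => by
    rw [hg, Real.sq_sqrt (hE0 τ)]
    have h1 := hid τ hτ
    have h2 := hI τ hτ
    have h3 : 0 ≤ 2 * ν * D τ := by
      have := hD0 τ hτ.2
      positivity
    linarith
  have hSle : S ≤ Real.sqrt (2 * S * N) := by
    refine csSup_le hne ?_
    rintro _ ⟨τ, hτ, rfl⟩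
    rw [← Real.sqrt_sq (hg0 τ)]
    exact Real.sqrt_le_sqrt (hg2 τ hτ)
  have hS2 : S ^ 2 ≤ 2 * S * N := by
    have h := pow_le_pow_left₀ hS0 hSle 2
    rwa [Real.sq_sqrt (by positivity)] at h
  have hS2N : S ≤ 2 * N := by
    nlinarith [mul_nonneg hS0 hN0, sq_nonneg (S - 2 * N), hS2, hS0, hN0]
  -- conclusions
  refine ⟨fun τ hτ => (hgS τ hτ).trans hS2N, ?_⟩
  have h0 := hid 0 ⟨le_rfl, hT⟩
  have h1 := hI 0 ⟨le_rfl, hT⟩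
  have h2 : 2 * S * N ≤ 2 * (2 * N) * N := by
    have := mul_le_mul_of_nonneg_right hS2N hN0
    nlinarith
  have h3 := hE0 0
  show ν * D 0 ≤ 2 * N ^ 2
  nlinarith

end EnergyL1

/-! ### The gradient at time `0` through the second energy identity -/

section EnergyOneZero

variable {ν : ℝ} {Θ : ℝ → E → F}

/-- **Gradient bound at the initial time** (from Lemarié-Rieusset 2016, Prop. 4.3 (C)): for
`U = 𝒰[Θ]`, `Θ` supported in time in `[a, b]`, `0 ≤ T`, `b ≤ T`,
`Σᵢ ‖∂ᵢU(0)‖₂² ≤ (2n/ν) ∫₀ᵀ ‖Θ(s)‖₂² ds` (`n = dim E`).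
Proof: the second energy identity at `τ = 0` gives `Σᵢ‖∂ᵢU(0)‖₂² ≤ 2∫∫|⟪ΔU, Θ⟫| ≤
2‖ΔU‖_{L²(slab)} Q^{1/2}`, and `‖ΔU‖²_{L²(slab)} ≤ n X ≤ n² Q/ν²` by maximal regularity. [cite: LemarieRieusset2016, Prop. 4.3 (C), p. 74] -/
theorem IsSpaceTimeTestOn.sum_integral_sq_norm_fderiv_heatDuhamelBack_zero_le
    (hΘ : IsSpaceTimeTestOn (⊤ : Opens (ℝ × E)) Θ) (hν : 0 < ν) {a b : ℝ}
    (hab : ∀ t, t ∉ Icc a b → Θ t = 0) {T : ℝ} (hT : 0 ≤ T) (hbT : b ≤ T) :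
    ∑ i, ∫ x, ‖fderiv ℝ (heatDuhamelBack ν Θ 0) x (stdOrthonormalBasis ℝ E i)‖ ^ 2 ≤
      2 * (Module.finrank ℝ E : ℝ) / ν * ∫ s in (0 : ℝ)..T, ∫ x, ‖Θ s x‖ ^ 2 := by
  set bE := stdOrthonormalBasis ℝ E
  set n : ℝ := (Module.finrank ℝ E : ℝ) with hn
  set μ : Measure (E × ℝ) := (volume : Measure E).prod (volume.restrict (Ioc 0 T)) with hμ
  set Q : ℝ := ∫ s in (0 : ℝ)..T, ∫ x, ‖Θ s x‖ ^ 2 with hQ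
  have hQ' : ∫ q, ‖Θ q.2 q.1‖ ^ 2 ∂μ = Q := hΘ.integral_prod_sq_norm_eq hT
  have hQ0 : 0 ≤ Q := by
    rw [← hQ']
    exact integral_nonneg fun _ => by positivity
  have hΘl : IsSpaceTimeTestOn (⊤ : Opens (ℝ × E)) (fun t => Δ (Θ t)) := hΘ.laplacian_top
  have hΘi : ∀ i, IsSpaceTimeTestOn (⊤ : Opens (ℝ × E)) (fun t y => fderiv ℝ (Θ t) y (bE i)) :=
    fun i => hΘ.fderiv_apply_top (bE i)
  have hΔ : ∀ s x, (Δ (heatDuhamelBack ν Θ s)) x = heatDuhamelBack ν (fun t => Δ (Θ t)) s x :=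
    fun s x => hΘ.laplacian_heatDuhamelBack hν s x
  -- `X` and its bound by maximal regularity
  set X : ℝ := ∫ s in (0 : ℝ)..T, ∑ i, ∑ j, ∫ x,
    ‖fderiv ℝ (fun y => fderiv ℝ (heatDuhamelBack ν Θ s) y (bE i)) x (bE j)‖ ^ 2 with hX
  have hXle : X ≤ n / ν ^ 2 * Q := hΘ.energy_estimate_one hν hab hT hbT
  have hX0 : 0 ≤ X :=
    intervalIntegral.integral_nonneg hT fun s _ => Finset.sum_nonneg fun i _ =>
      Finset.sum_nonneg fun j _ => integral_nonneg fun _ => by positivity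
  have hUi : ∀ i s, heatDuhamelBack ν (fun t y => fderiv ℝ (Θ t) y (bE i)) s =
      fun x => fderiv ℝ (heatDuhamelBack ν Θ s) x (bE i) := fun i s =>
    funext fun x => (hΘ.fderiv_heatDuhamelBack_apply hν s x (bE i)).symm
  have hUij : ∀ i j s x, fderiv ℝ (fun y => fderiv ℝ (heatDuhamelBack ν Θ s) y (bE i)) x (bE j) =
      heatDuhamelBack ν (fun t y => fderiv ℝ (fun z => fderiv ℝ (Θ t) z (bE i)) y (bE j)) s x :=
    fun i j s x => by
    rw [← hUi i s]
    exact (hΘi i).fderiv_heatDuhamelBack_apply hν s x (bE j)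
  have iij : ∀ i j s, Integrable (fun x =>
      ‖fderiv ℝ (fun y => fderiv ℝ (heatDuhamelBack ν Θ s) y (bE i)) x (bE j)‖ ^ 2) volume :=
    fun i j s => by
    have hm := ((hΘi i).fderiv_apply_top (bE j)).memLp_two_heatDuhamelBack hν s
    have h := (memLp_two_iff_integrable_sq_norm hm.1).1 hm
    refine h.congr (Eventually.of_forall fun x => ?_)
    simp only [hUij]
  have ie₂ : IntegrableOn (fun s => ∑ i, ∑ j, ∫ x,
      ‖fderiv ℝ (fun y => fderiv ℝ (heatDuhamelBack ν Θ s) y (bE i)) x (bE j)‖ ^ 2)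
      (Ioc 0 T) volume := by
    refine integrable_finsetSum _ fun i _ => integrable_finsetSum _ fun j _ => ?_
    have hΘij := (hΘi i).fderiv_apply_top (bE j)
    have h := (hΘij.integrable_prod_sq_norm_heatDuhamelBack hν 0 T).integral_prod_right
    refine h.congr (Eventually.of_forall fun s => integral_congr_ae (Eventually.of_forall fun x => ?_))
    simp only [hUij]
  -- the pairing `J = ∫∫ |⟪ΔU, Θ⟫|`
  have hjoint := hΘl.integrable_prod_inner_heatDuhamelBack_test hΘ hν 0 T
  set J : ℝ := ∫ q, |⟪heatDuhamelBack ν (fun t => Δ (Θ t)) q.2 q.1, Θ q.2 q.1⟫| ∂μ with hJ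
  -- (i) `Y ≤ 2J` from the second energy identity at `τ = 0`
  have hY : ∑ i, ∫ x, ‖fderiv ℝ (heatDuhamelBack ν Θ 0) x (bE i)‖ ^ 2 ≤ 2 * J := by
    have hE := hΘ.energy_identity_one hν hab hT hbT
    have hP : -(∫ s in (0 : ℝ)..T, ∫ x, ⟪(Δ (heatDuhamelBack ν Θ s)) x, Θ s x⟫) ≤ J := by
      have ipabs : IntervalIntegrable (fun s => ∫ x,
          |⟪heatDuhamelBack ν (fun t => Δ (Θ t)) s x, Θ s x⟫|) volume 0 T := by
        rw [intervalIntegrable_iff_integrableOn_Ioc_of_le hT]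
        exact hjoint.abs.integral_prod_right
      have ip : IntervalIntegrable (fun s => ∫ x,
          ⟪heatDuhamelBack ν (fun t => Δ (Θ t)) s x, Θ s x⟫) volume 0 T := by
        rw [intervalIntegrable_iff_integrableOn_Ioc_of_le hT]
        exact hjoint.integral_prod_right
      simp_rw [hΔ]
      rw [← intervalIntegral.integral_neg]
      calc ∫ s in (0 : ℝ)..T, -∫ x, ⟪heatDuhamelBack ν (fun t => Δ (Θ t)) s x, Θ s x⟫
          ≤ ∫ s in (0 : ℝ)..T, ∫ x, |⟪heatDuhamelBack ν (fun t => Δ (Θ t)) s x, Θ s x⟫| :=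
            intervalIntegral.integral_mono_on hT ip.neg ipabs fun s _ =>
              (neg_le_abs _).trans abs_integral_le_integral_abs
        _ = J := by rw [hJ, integral_prod_symm _ hjoint.abs, intervalIntegral.integral_of_le hT]
    have h2νX : 0 ≤ 2 * ν * X := by positivity
    linarith
  -- (ii) Cauchy–Schwarz and `‖ΔU‖²_{L²(slab)} ≤ n X`
  have hCS : J ≤ (∫ q, ‖heatDuhamelBack ν (fun t => Δ (Θ t)) q.2 q.1‖ ^ 2 ∂μ) ^ (1 / 2 : ℝ) *
      Q ^ (1 / 2 : ℝ) := by
    rw [← hQ']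
    exact integral_abs_inner_le_sqrt_mul_sqrt (hΘl.memLp_two_prod_heatDuhamelBack hν 0 T)
      (hΘ.memLp_two_prod 0 T)
  have hΔΔ : ∫ q, ‖heatDuhamelBack ν (fun t => Δ (Θ t)) q.2 q.1‖ ^ 2 ∂μ ≤ n * X := by
    rw [hμ, integral_prod_symm _ (hΘl.integrable_prod_sq_norm_heatDuhamelBack hν 0 T), hX,
      intervalIntegral.integral_of_le hT, ← integral_const_mul]
    have hi : IntegrableOn (fun s => ∫ x, ‖heatDuhamelBack ν (fun t => Δ (Θ t)) s x‖ ^ 2)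
        (Ioc 0 T) volume :=
      (hΘl.integrable_prod_sq_norm_heatDuhamelBack hν 0 T).integral_prod_right
    refine setIntegral_mono_on hi (ie₂.const_mul n) measurableSet_Ioc fun s _ => ?_
    dsimp only
    have isum : Integrable (fun x => ∑ i, ∑ j,
        ‖fderiv ℝ (fun y => fderiv ℝ (heatDuhamelBack ν Θ s) y (bE i)) x (bE j)‖ ^ 2) volume :=
      integrable_finsetSum _ fun i _ => integrable_finsetSum _ fun j _ => iij i j s
    have hrhs : ∫ x, n * ∑ i, ∑ j,
        ‖fderiv ℝ (fun y => fderiv ℝ (heatDuhamelBack ν Θ s) y (bE i)) x (bE j)‖ ^ 2 =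
        n * ∑ i, ∑ j, ∫ x,
          ‖fderiv ℝ (fun y => fderiv ℝ (heatDuhamelBack ν Θ s) y (bE i)) x (bE j)‖ ^ 2 := by
      rw [integral_const_mul, integral_finsetSum _ fun i _ =>
        integrable_finsetSum _ fun j _ => iij i j s]
      congr 1
      exact Finset.sum_congr rfl fun i _ => integral_finsetSum _ fun j _ => iij i j s
    rw [← hrhs]
    refine integral_mono_of_nonneg (Eventually.of_forall fun _ => by positivity) (isum.const_mul n)
      (Eventually.of_forall fun x => ?_)
    dsimp only
    rw [← hΔ s x]
    exact norm_laplacian_sq_le (hΘ.contDiff_two_heatDuhamelBack hν s) x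
  -- (iii) algebra
  have hn0 : 0 ≤ n := by positivity
  have h1 : J ≤ Real.sqrt (n * X) * Real.sqrt Q := by
    have h := hCS.trans (mul_le_mul_of_nonneg_right (Real.rpow_le_rpow
      (integral_nonneg fun _ => by positivity) hΔΔ (by norm_num)) (Real.rpow_nonneg hQ0 _))
    rwa [← Real.sqrt_eq_rpow, ← Real.sqrt_eq_rpow] at h
  have h2 : Real.sqrt (n * X) ≤ n / ν * Real.sqrt Q := by
    have hx : n * X ≤ (n / ν * Real.sqrt Q) ^ 2 := by
      rw [mul_pow, div_pow, Real.sq_sqrt hQ0]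
      have := mul_le_mul_of_nonneg_left hXle hn0
      calc n * X ≤ n * (n / ν ^ 2 * Q) := this
        _ = n ^ 2 / ν ^ 2 * Q := by ring
    calc Real.sqrt (n * X) ≤ Real.sqrt ((n / ν * Real.sqrt Q) ^ 2) := Real.sqrt_le_sqrt hx
      _ = n / ν * Real.sqrt Q := Real.sqrt_sq (by positivity)
  calc ∑ i, ∫ x, ‖fderiv ℝ (heatDuhamelBack ν Θ 0) x (bE i)‖ ^ 2 ≤ 2 * J := hY
    _ ≤ 2 * (n / ν * Real.sqrt Q * Real.sqrt Q) := by
        have := h1.trans (mul_le_mul_of_nonneg_right h2 (Real.sqrt_nonneg Q))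
        linarith
    _ = 2 * n / ν * Q := by
        rw [mul_assoc (n / ν), Real.mul_self_sqrt hQ0]; ring

end EnergyOneZero

/-! ### Operator norms through frame sums -/

section OpNorm

variable {G : Type*} [NormedAddCommGroup G] [NormedSpace ℝ G]

omit [MeasurableSpace E] [BorelSpace E] [FiniteDimensional ℝ E] in
/-- `‖L‖ ≤ (Σᵢ ‖L bᵢ‖²)^{1/2}` for a continuous linear map out of a finite-dimensional inner
product space and an orthonormal basis `b` (expand `x = Σ ⟪bᵢ, x⟫ bᵢ` and Cauchy–Schwarz). [folklore] -/
theorem opNorm_le_sqrt_sum_sq {ι : Type*} [Fintype ι] (b : OrthonormalBasis ι ℝ E) (L : E →L[ℝ] G) :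
    ‖L‖ ≤ Real.sqrt (∑ i, ‖L (b i)‖ ^ 2) := by
  refine ContinuousLinearMap.opNorm_le_bound _ (Real.sqrt_nonneg _) fun x => ?_
  have hx : L x = ∑ i, ⟪b i, x⟫ • L (b i) := by
    conv_lhs => rw [← b.sum_repr' x]
    rw [map_sum]
    exact Finset.sum_congr rfl fun i _ => by rw [map_smul]
  rw [hx]
  calc ‖∑ i, ⟪b i, x⟫ • L (b i)‖ ≤ ∑ i, ‖⟪b i, x⟫ • L (b i)‖ := norm_sum_le _ _
    _ = ∑ i, |⟪b i, x⟫| * ‖L (b i)‖ := by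
        refine Finset.sum_congr rfl fun i _ => ?_
        rw [norm_smul, Real.norm_eq_abs]
    _ ≤ Real.sqrt (∑ i, |⟪b i, x⟫| ^ 2) * Real.sqrt (∑ i, ‖L (b i)‖ ^ 2) := by
        have h := Finset.sum_mul_sq_le_sq_mul_sq Finset.univ (fun i => |⟪b i, x⟫|) fun i => ‖L (b i)‖
        have h0 : 0 ≤ ∑ i, |⟪b i, x⟫| * ‖L (b i)‖ := Finset.sum_nonneg fun i _ => by positivity
        rw [← Real.sqrt_mul (Finset.sum_nonneg fun i _ => by positivity), Real.le_sqrt h0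
          (mul_nonneg (Finset.sum_nonneg fun i _ => by positivity)
            (Finset.sum_nonneg fun i _ => by positivity))]
        exact h
    _ = Real.sqrt (∑ i, ‖L (b i)‖ ^ 2) * ‖x‖ := by
        have hP : ∑ i, |⟪b i, x⟫| ^ 2 = ‖x‖ ^ 2 := by
          have := b.sum_sq_norm_inner_right x
          simpa [Real.norm_eq_abs] using this
        rw [hP, Real.sqrt_sq (norm_nonneg _), mul_comm]

omit [MeasurableSpace E] [BorelSpace E] in
set_option maxSynthPendingDepth 2 in
/-- `‖D²g(x)‖² ≤ Σᵢ Σⱼ |∂ⱼ∂ᵢ g(x)|²` for the operator norm of the second derivative of a scalar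
function, in the standard frame. [folklore] -/
theorem norm_fderiv_fderiv_sq_le_sum_sum {g : E → ℝ} (x : E) :
    ‖fderiv ℝ (fderiv ℝ g) x‖ ^ 2 ≤ ∑ i, ∑ j,
      ‖fderiv ℝ (fun y => fderiv ℝ g y (stdOrthonormalBasis ℝ E i)) x (stdOrthonormalBasis ℝ E j)‖ ^ 2 := by
  set b := stdOrthonormalBasis ℝ E
  by_cases hd : DifferentiableAt ℝ (fderiv ℝ g) x
  · have hij : ∀ i j, fderiv ℝ (fun y => fderiv ℝ g y (b i)) x (b j) =
        fderiv ℝ (fderiv ℝ g) x (b j) (b i) := fun i j => by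
      rw [fderiv_clm_apply hd (differentiableAt_const _)]
      simp
    have h1 : ‖fderiv ℝ (fderiv ℝ g) x‖ ^ 2 ≤ ∑ j, ‖fderiv ℝ (fderiv ℝ g) x (b j)‖ ^ 2 := by
      have h := opNorm_le_sqrt_sum_sq b (fderiv ℝ (fderiv ℝ g) x)
      calc ‖fderiv ℝ (fderiv ℝ g) x‖ ^ 2 ≤ (Real.sqrt (∑ j, ‖fderiv ℝ (fderiv ℝ g) x (b j)‖ ^ 2)) ^ 2 := by
            gcongr
        _ = ∑ j, ‖fderiv ℝ (fderiv ℝ g) x (b j)‖ ^ 2 :=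
            Real.sq_sqrt (Finset.sum_nonneg fun _ _ => by positivity)
    have h2 : ∀ j, ‖fderiv ℝ (fderiv ℝ g) x (b j)‖ ^ 2 ≤ ∑ i, ‖fderiv ℝ (fderiv ℝ g) x (b j) (b i)‖ ^ 2 :=
      fun j => by
      have h := opNorm_le_sqrt_sum_sq b (fderiv ℝ (fderiv ℝ g) x (b j))
      calc ‖fderiv ℝ (fderiv ℝ g) x (b j)‖ ^ 2
          ≤ (Real.sqrt (∑ i, ‖fderiv ℝ (fderiv ℝ g) x (b j) (b i)‖ ^ 2)) ^ 2 := by gcongr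
        _ = ∑ i, ‖fderiv ℝ (fderiv ℝ g) x (b j) (b i)‖ ^ 2 :=
            Real.sq_sqrt (Finset.sum_nonneg fun _ _ => by positivity)
    calc ‖fderiv ℝ (fderiv ℝ g) x‖ ^ 2 ≤ ∑ j, ‖fderiv ℝ (fderiv ℝ g) x (b j)‖ ^ 2 := h1
      _ ≤ ∑ j, ∑ i, ‖fderiv ℝ (fderiv ℝ g) x (b j) (b i)‖ ^ 2 := Finset.sum_le_sum fun j _ => h2 j
      _ = ∑ i, ∑ j, ‖fderiv ℝ (fun y => fderiv ℝ g y (b i)) x (b j)‖ ^ 2 := by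
          rw [Finset.sum_comm]
          simp only [hij]
  · rw [fderiv_zero_of_not_differentiableAt hd, ContinuousLinearMap.opNorm_zero]
    simp only [ne_eq, OfNat.ofNat_ne_zero, not_false_eq_true, zero_pow]
    exact Finset.sum_nonneg fun i _ => Finset.sum_nonneg fun j _ => by positivity

end OpNorm

/-! ### Between the two slab measures -/

section SlabSwap

variable {G : Type*} [NormedAddCommGroup G] [NormedSpace ℝ G]

/-- **Swapping the slab measures**: integrals over `(vol|_(0,T)) × vol` on `ℝ × E` are integrals
of the swapped function over `vol × (vol|_(0,T])` on `E × ℝ`. [folklore] -/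
theorem integral_slab_swap (T : ℝ) (f : ℝ × E → G) :
    ∫ p, f p ∂((volume.restrict (Ioo 0 T)).prod (volume : Measure E)) =
      ∫ q, f (q.2, q.1) ∂((volume : Measure E).prod (volume.restrict (Ioc 0 T))) := by
  rw [restrict_Ioo_eq_restrict_Ioc, ← integral_prod_swap]
  rfl

omit [NormedSpace ℝ G] in
/-- Integrability transfers between the two slab measures. [folklore] -/
theorem integrable_slab_of_swap {T : ℝ} {f : ℝ × E → G}
    (h : Integrable (fun q : E × ℝ => f (q.2, q.1)) ((volume : Measure E).prod (volume.restrict (Ioc 0 T)))) :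
    Integrable f ((volume.restrict (Ioo 0 T)).prod (volume : Measure E)) := by
  rw [restrict_Ioo_eq_restrict_Ioc]
  have h' := h.swap
  exact h'

variable {ν : ℝ}

/-- `‖𝒰[Θ]‖²` is integrable on the slab `(0,T) × E` (time first). [folklore] -/
theorem IsSpaceTimeTestOn.integrable_sq_norm_heatDuhamelBack_slab {Θ : ℝ → E → F}
    (hΘ : IsSpaceTimeTestOn (⊤ : Opens (ℝ × E)) Θ) (hν : 0 < ν) (T : ℝ) :
    Integrable (fun p : ℝ × E => ‖heatDuhamelBack ν Θ p.1 p.2‖ ^ 2)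
      ((volume.restrict (Ioo 0 T)).prod (volume : Measure E)) :=
  integrable_slab_of_swap (hΘ.integrable_prod_sq_norm_heatDuhamelBack hν 0 T)

/-- `∫_{(0,T)×E} ‖𝒰[Θ]‖² = ∫_{(0,T]} ∫ ‖𝒰[Θ](s)‖²`. [folklore] -/
theorem IsSpaceTimeTestOn.integral_sq_norm_heatDuhamelBack_slab {Θ : ℝ → E → F}
    (hΘ : IsSpaceTimeTestOn (⊤ : Opens (ℝ × E)) Θ) (hν : 0 < ν) (T : ℝ) :
    ∫ p, ‖heatDuhamelBack ν Θ p.1 p.2‖ ^ 2 ∂((volume.restrict (Ioo 0 T)).prod (volume : Measure E)) =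
      ∫ s in Ioc 0 T, ∫ x, ‖heatDuhamelBack ν Θ s x‖ ^ 2 := by
  rw [integral_slab_swap, integral_prod_symm _ (hΘ.integrable_prod_sq_norm_heatDuhamelBack hν 0 T)]

omit [CompleteSpace F] in
/-- `∫_{(0,T)×E} ‖Θ‖² = ∫₀ᵀ ∫ ‖Θ(s)‖²` for a space–time test field and `0 ≤ T`. [folklore] -/
theorem IsSpaceTimeTestOn.integral_sq_norm_slab {Θ : ℝ → E → F}
    (hΘ : IsSpaceTimeTestOn (⊤ : Opens (ℝ × E)) Θ) {T : ℝ} (hT : 0 ≤ T) :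
    ∫ p, ‖Θ p.1 p.2‖ ^ 2 ∂((volume.restrict (Ioo 0 T)).prod (volume : Measure E)) =
      ∫ s in (0 : ℝ)..T, ∫ x, ‖Θ s x‖ ^ 2 := by
  rw [integral_slab_swap, ← hΘ.integral_prod_sq_norm_eq hT]

end SlabSwap

/-! ### The two quantitative duality bounds -/

section Bounds

variable {ν T : ℝ} {v₀ : E → E} {v : ℝ → E → E} {θ : ℝ → E → ℝ}

omit [FiniteDimensional ℝ E] [MeasurableSpace E] [BorelSpace E] in
/-- **The `L⁴`–`L²` Cauchy–Schwarz step**: `|∫ ⟪V, A V⟫| ≤ ‖V‖²_{L⁴} ‖A‖_{L²}` on any measure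
space, for an operator field `A ∈ L²` and `V ∈ L⁴`. [folklore] -/
theorem abs_integral_inner_clm_apply_le {α : Type*} [MeasurableSpace α] {μ : Measure α}
    {V : α → E} {A : α → E →L[ℝ] E} (hV : MemLp V 4 μ) (hA : MemLp A 2 μ) :
    |∫ z, ⟪V z, A z (V z)⟫ ∂μ| ≤
      Real.sqrt (∫ z, ‖V z‖ ^ 4 ∂μ) * Real.sqrt (∫ z, ‖A z‖ ^ 2 ∂μ) := by
  have hV2 : MemLp (fun z => ‖V z‖ ^ 2) 2 μ := by
    have h := hV.norm_rpow_div 2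
    have h42 : (4 : ℝ≥0∞) / 2 = 2 := ((ENNReal.eq_div_iff (by norm_num) (by norm_num)).2 (by norm_num)).symm
    rw [h42] at h
    refine h.congr_norm (hV.1.norm.pow 2) (Eventually.of_forall fun z => ?_)
    simp
  have h := integral_norm_mul_norm_le_sqrt_mul_sqrt hV2 hA
  have h4 : ∫ z, ‖‖V z‖ ^ 2‖ ^ 2 ∂μ = ∫ z, ‖V z‖ ^ 4 ∂μ := by
    refine integral_congr_ae (Eventually.of_forall fun z => ?_)
    dsimp only
    rw [Real.norm_of_nonneg (by positivity), ← pow_mul]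
  rw [h4] at h
  refine le_trans ?_ h
  have hi : Integrable (fun z => ‖‖V z‖ ^ 2‖ * ‖A z‖) μ := hV2.norm.integrable_mul hA.norm
  refine (abs_integral_le_integral_abs).trans (integral_mono_of_nonneg
    (Eventually.of_forall fun _ => abs_nonneg _) hi (Eventually.of_forall fun z => ?_))
  dsimp only
  calc |⟪V z, A z (V z)⟫| ≤ ‖V z‖ * ‖A z (V z)‖ := abs_real_inner_le_norm _ _
    _ ≤ ‖V z‖ * (‖A z‖ * ‖V z‖) := by gcongr; exact ContinuousLinearMap.le_opNorm _ _
    _ = ‖‖V z‖ ^ 2‖ * ‖A z‖ := by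
        rw [Real.norm_of_nonneg (by positivity)]; ring

omit [CompleteSpace F] in
/-- `|∫ ⟪f, g⟫| ≤ ‖f‖₂ ‖g‖₂` (Cauchy–Schwarz with square roots). [folklore] -/
theorem abs_integral_inner_le_sqrt_mul_sqrt' {α : Type*} [MeasurableSpace α] {μ : Measure α}
    {f g : α → F} (hf : MemLp f 2 μ) (hg : MemLp g 2 μ) :
    |∫ z, ⟪f z, g z⟫ ∂μ| ≤ Real.sqrt (∫ z, ‖f z‖ ^ 2 ∂μ) * Real.sqrt (∫ z, ‖g z‖ ^ 2 ∂μ) := by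
  have h := integral_abs_inner_le_sqrt_mul_sqrt hf hg
  rw [← Real.sqrt_eq_rpow, ← Real.sqrt_eq_rpow] at h
  exact (abs_integral_le_integral_abs).trans h

/-! #### Frame sums of derivatives of Duhamel fields on the slab -/

/-- **First derivatives on the slab**: `Σᵢ ‖∂ᵢ𝒰[Θ]‖²` is integrable on `(0,T) × E` and its
integral is `∫₀ᵀ Σᵢ ‖∂ᵢ𝒰[Θ](s)‖₂² ds`. [folklore] -/
theorem IsSpaceTimeTestOn.integral_sum_sq_norm_fderiv_heatDuhamelBack_slab {Θ : ℝ → E → F}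
    (hΘ : IsSpaceTimeTestOn (⊤ : Opens (ℝ × E)) Θ) (hν : 0 < ν) {T : ℝ} (hT : 0 ≤ T) :
    Integrable (fun p : ℝ × E => ∑ i, ‖fderiv ℝ (heatDuhamelBack ν Θ p.1) p.2
        (stdOrthonormalBasis ℝ E i)‖ ^ 2) ((volume.restrict (Ioo 0 T)).prod (volume : Measure E)) ∧
      ∫ p, ∑ i, ‖fderiv ℝ (heatDuhamelBack ν Θ p.1) p.2 (stdOrthonormalBasis ℝ E i)‖ ^ 2
          ∂((volume.restrict (Ioo 0 T)).prod (volume : Measure E)) =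
        ∫ s in (0 : ℝ)..T, ∑ i, ∫ x, ‖fderiv ℝ (heatDuhamelBack ν Θ s) x
          (stdOrthonormalBasis ℝ E i)‖ ^ 2 := by
  set bE := stdOrthonormalBasis ℝ E
  set μ : Measure (ℝ × E) := (volume.restrict (Ioo 0 T)).prod (volume : Measure E) with hμ
  have hΘi : ∀ i, IsSpaceTimeTestOn (⊤ : Opens (ℝ × E)) (fun t y => fderiv ℝ (Θ t) y (bE i)) :=
    fun i => hΘ.fderiv_apply_top (bE i)
  have hUi : ∀ i s x, fderiv ℝ (heatDuhamelBack ν Θ s) x (bE i) =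
      heatDuhamelBack ν (fun t y => fderiv ℝ (Θ t) y (bE i)) s x := fun i s x =>
    hΘ.fderiv_heatDuhamelBack_apply hν s x (bE i)
  have ii : ∀ i, Integrable (fun p : ℝ × E => ‖fderiv ℝ (heatDuhamelBack ν Θ p.1) p.2 (bE i)‖ ^ 2) μ :=
    fun i => ((hΘi i).integrable_sq_norm_heatDuhamelBack_slab hν T).congr
      (Eventually.of_forall fun p => by simp only [hUi])
  have isum : Integrable (fun p : ℝ × E => ∑ i, ‖fderiv ℝ (heatDuhamelBack ν Θ p.1) p.2 (bE i)‖ ^ 2) μ :=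
    integrable_finsetSum _ fun i _ => ii i
  refine ⟨isum, ?_⟩
  rw [integral_finsetSum _ fun i _ => ii i]
  have hI : ∀ i, ∫ p, ‖fderiv ℝ (heatDuhamelBack ν Θ p.1) p.2 (bE i)‖ ^ 2 ∂μ =
      ∫ s in Ioc 0 T, ∫ x, ‖fderiv ℝ (heatDuhamelBack ν Θ s) x (bE i)‖ ^ 2 := fun i => by
    have h := (hΘi i).integral_sq_norm_heatDuhamelBack_slab hν T
    simp only [← hUi] at h
    exact h
  have hint : ∀ i, IntegrableOn (fun s => ∫ x, ‖fderiv ℝ (heatDuhamelBack ν Θ s) x (bE i)‖ ^ 2)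
      (Ioc 0 T) volume := fun i =>
    ((hΘi i).integrable_prod_sq_norm_heatDuhamelBack hν 0 T).integral_prod_right.congr
      (Eventually.of_forall fun s => by simp only [hUi])
  simp only [hI]
  rw [intervalIntegral.integral_of_le hT, integral_finsetSum _ fun i _ => hint i]

/-- **Second derivatives on the slab**: `Σᵢ Σⱼ ‖∂ⱼ∂ᵢ𝒰[Θ]‖²` is integrable on `(0,T) × E` and its
integral is `∫₀ᵀ Σᵢ Σⱼ ‖∂ⱼ∂ᵢ𝒰[Θ](s)‖₂² ds`. [folklore] -/
theorem IsSpaceTimeTestOn.integral_sum_sum_sq_norm_fderiv_fderiv_heatDuhamelBack_slab {Θ : ℝ → E → F}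
    (hΘ : IsSpaceTimeTestOn (⊤ : Opens (ℝ × E)) Θ) (hν : 0 < ν) {T : ℝ} (hT : 0 ≤ T) :
    Integrable (fun p : ℝ × E => ∑ i, ∑ j, ‖fderiv ℝ (fun y => fderiv ℝ (heatDuhamelBack ν Θ p.1) y
        (stdOrthonormalBasis ℝ E i)) p.2 (stdOrthonormalBasis ℝ E j)‖ ^ 2)
        ((volume.restrict (Ioo 0 T)).prod (volume : Measure E)) ∧
      ∫ p, ∑ i, ∑ j, ‖fderiv ℝ (fun y => fderiv ℝ (heatDuhamelBack ν Θ p.1) y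
          (stdOrthonormalBasis ℝ E i)) p.2 (stdOrthonormalBasis ℝ E j)‖ ^ 2
          ∂((volume.restrict (Ioo 0 T)).prod (volume : Measure E)) =
        ∫ s in (0 : ℝ)..T, ∑ i, ∑ j, ∫ x, ‖fderiv ℝ (fun y => fderiv ℝ (heatDuhamelBack ν Θ s) y
          (stdOrthonormalBasis ℝ E i)) x (stdOrthonormalBasis ℝ E j)‖ ^ 2 := by
  set bE := stdOrthonormalBasis ℝ E
  set μ : Measure (ℝ × E) := (volume.restrict (Ioo 0 T)).prod (volume : Measure E) with hμ
  have hΘi : ∀ i, IsSpaceTimeTestOn (⊤ : Opens (ℝ × E)) (fun t y => fderiv ℝ (Θ t) y (bE i)) :=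
    fun i => hΘ.fderiv_apply_top (bE i)
  have hΘij : ∀ i j, IsSpaceTimeTestOn (⊤ : Opens (ℝ × E))
      (fun t y => fderiv ℝ (fun z => fderiv ℝ (Θ t) z (bE i)) y (bE j)) := fun i j =>
    (hΘi i).fderiv_apply_top (bE j)
  have hUi : ∀ i s, heatDuhamelBack ν (fun t y => fderiv ℝ (Θ t) y (bE i)) s =
      fun x => fderiv ℝ (heatDuhamelBack ν Θ s) x (bE i) := fun i s =>
    funext fun x => (hΘ.fderiv_heatDuhamelBack_apply hν s x (bE i)).symm
  have hUij : ∀ i j s x, fderiv ℝ (fun y => fderiv ℝ (heatDuhamelBack ν Θ s) y (bE i)) x (bE j) =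
      heatDuhamelBack ν (fun t y => fderiv ℝ (fun z => fderiv ℝ (Θ t) z (bE i)) y (bE j)) s x :=
    fun i j s x => by
    rw [← hUi i s]
    exact (hΘi i).fderiv_heatDuhamelBack_apply hν s x (bE j)
  have ii : ∀ i j, Integrable (fun p : ℝ × E =>
      ‖fderiv ℝ (fun y => fderiv ℝ (heatDuhamelBack ν Θ p.1) y (bE i)) p.2 (bE j)‖ ^ 2) μ := fun i j =>
    ((hΘij i j).integrable_sq_norm_heatDuhamelBack_slab hν T).congr
      (Eventually.of_forall fun p => by simp only [hUij])
  have isum : Integrable (fun p : ℝ × E => ∑ i, ∑ j,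
      ‖fderiv ℝ (fun y => fderiv ℝ (heatDuhamelBack ν Θ p.1) y (bE i)) p.2 (bE j)‖ ^ 2) μ :=
    integrable_finsetSum _ fun i _ => integrable_finsetSum _ fun j _ => ii i j
  refine ⟨isum, ?_⟩
  rw [integral_finsetSum _ fun i _ => integrable_finsetSum _ fun j _ => ii i j]
  have hI : ∀ i j, ∫ p, ‖fderiv ℝ (fun y => fderiv ℝ (heatDuhamelBack ν Θ p.1) y (bE i)) p.2 (bE j)‖ ^ 2 ∂μ =
      ∫ s in Ioc 0 T, ∫ x, ‖fderiv ℝ (fun y => fderiv ℝ (heatDuhamelBack ν Θ s) y (bE i)) x (bE j)‖ ^ 2 :=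
    fun i j => by
    have h := (hΘij i j).integral_sq_norm_heatDuhamelBack_slab hν T
    simp only [← hUij] at h
    exact h
  have hint : ∀ i j, IntegrableOn (fun s => ∫ x,
      ‖fderiv ℝ (fun y => fderiv ℝ (heatDuhamelBack ν Θ s) y (bE i)) x (bE j)‖ ^ 2) (Ioc 0 T) volume :=
    fun i j => ((hΘij i j).integrable_prod_sq_norm_heatDuhamelBack hν 0 T).integral_prod_right.congr
      (Eventually.of_forall fun s => by simp only [hUij])
  have hstep : ∀ i, ∑ j, ∫ p, ‖fderiv ℝ (fun y => fderiv ℝ (heatDuhamelBack ν Θ p.1) y (bE i)) p.2 (bE j)‖ ^ 2 ∂μ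
      = ∫ s in Ioc 0 T, ∑ j, ∫ x, ‖fderiv ℝ (fun y => fderiv ℝ (heatDuhamelBack ν Θ s) y (bE i)) x (bE j)‖ ^ 2 :=
    fun i => by
    rw [integral_finsetSum _ fun j _ => hint i j]
    exact Finset.sum_congr rfl fun j _ => hI i j
  rw [intervalIntegral.integral_of_le hT,
    integral_finsetSum _ fun i _ => integrable_finsetSum _ fun j _ => hint i j]
  exact Finset.sum_congr rfl fun i _ => by
    rw [integral_finsetSum _ fun j _ => ii i j]
    exact hstep i

/-! #### The bounds -/

omit [FiniteDimensional ℝ E] [MeasurableSpace E] [BorelSpace E] in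
/-- If `θ(t) = 0` off `[a₀, b]` then so does its curl-type field. [folklore] -/
theorem curlPair_time_support {a c : E} {a₀ b : ℝ} (hab : ∀ t, t ∉ Icc a₀ b → θ t = 0) (t : ℝ)
    (ht : t ∉ Icc a₀ b) : (fun x => 𝐋[a, c] (fderiv ℝ (θ t) x)) = 0 := by
  funext x
  rw [Pi.zero_apply, show fderiv ℝ (θ t) x = 0 from congrFun (fderiv_slice_eq_zero_of_eq_zero (hab t ht)) x,
    map_zero]

/-- **The `L¹ₜ L²ₓ` duality bound, abstract form.** Let `v ∈ L⁴` of the slab `(0,T) × E`,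
`v₀ ∈ L²(E)`, `Φ` an `E`-valued space–time test field with `Φ(t) = 0` for `t ≥ b`, `b ≤ T`, and
suppose the duality identity `∫_{(0,T)×E} ⟪v, Φ⟫ = ∫_{(0,T)×E} ⟪v, (v·∇)U⟫ + ∫ ⟪v₀, U(0)⟫`
holds for `U = 𝒰[Φ]`. Then
`|∫_{(0,T)×E} ⟪v, Φ⟫| ≤ (√(2/ν) ‖v‖²_{L⁴(Q_T)} + 2 ‖v₀‖_{L²}) ∫₀ᵀ ‖Φ(s)‖_{L²} ds`:
`|∫⟪v, (v·∇)U⟫| ≤ ‖v‖²_{L⁴} ‖∇U‖_{L²(Q_T)}`, `|∫⟪v₀, U(0)⟫| ≤ ‖v₀‖₂ ‖U(0)‖₂`, and the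
`L¹ₜL²ₓ` energy estimate `‖U(0)‖₂ ≤ 2N`, `ν‖∇U‖²_{L²(Q_T)} ≤ 2N²`. [folklore] -/
theorem abs_integral_inner_le_L1_of_duality (hν : 0 < ν) (hT : 0 < T)
    (hvm : AEStronglyMeasurable (uncurry v) ((volume.restrict (Ioo 0 T)).prod (volume : Measure E)))
    (hv₀ : MemLp v₀ 2 volume)
    (hv4 : eLpNorm (uncurry v) 4 ((volume.restrict (Ioo 0 T)).prod (volume : Measure E)) < ⊤)
    {Φ : ℝ → E → E} (hΦt : IsSpaceTimeTestOn (⊤ : Opens (ℝ × E)) Φ) {b : ℝ} (hbT : b ≤ T)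
    (hb : ∀ t, b ≤ t → Φ t = 0)
    (hid : ∫ p, ⟪v p.1 p.2, Φ p.1 p.2⟫ ∂((volume.restrict (Ioo 0 T)).prod (volume : Measure E)) =
      (∫ p, ⟪v p.1 p.2, fderiv ℝ (heatDuhamelBack ν Φ p.1) p.2 (v p.1 p.2)⟫
          ∂((volume.restrict (Ioo 0 T)).prod (volume : Measure E))) +
        ∫ x, ⟪v₀ x, heatDuhamelBack ν Φ 0 x⟫) :
    |∫ p, ⟪v p.1 p.2, Φ p.1 p.2⟫ ∂((volume.restrict (Ioo 0 T)).prod (volume : Measure E))| ≤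
      (Real.sqrt (2 / ν) * Real.sqrt (∫ p, ‖v p.1 p.2‖ ^ 4
          ∂((volume.restrict (Ioo 0 T)).prod (volume : Measure E))) +
        2 * Real.sqrt (∫ x, ‖v₀ x‖ ^ 2)) *
        ∫ s in (0 : ℝ)..T, Real.sqrt (∫ x, ‖Φ s x‖ ^ 2) := by
  rw [hid]
  set bE := stdOrthonormalBasis ℝ E
  set μ : Measure (ℝ × E) := (volume.restrict (Ioo 0 T)).prod (volume : Measure E) with hμ
  obtain ⟨a₀, hab⟩ := hΦt.exists_time_support_of_le hb
  set U : ℝ → E → E := heatDuhamelBack ν Φ with hU_def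
  set N : ℝ := ∫ s in (0 : ℝ)..T, Real.sqrt (∫ x, ‖Φ s x‖ ^ 2) with hN
  have hN0 : 0 ≤ N := intervalIntegral.integral_nonneg hT.le fun s _ => Real.sqrt_nonneg _
  obtain ⟨hP1, hP2⟩ := hΦt.energy_estimate_L1 hν hab hT.le hbT
  -- the datum term
  have hV4 : MemLp (uncurry v) 4 μ := ⟨hvm, hv4⟩
  have hU0 : Real.sqrt (∫ x, ‖U 0 x‖ ^ 2) ≤ 2 * N := hP1 0 ⟨le_rfl, hT.le⟩
  have hI₀ : |∫ x, ⟪v₀ x, U 0 x⟫| ≤ Real.sqrt (∫ x, ‖v₀ x‖ ^ 2) * (2 * N) :=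
    (abs_integral_inner_le_sqrt_mul_sqrt' hv₀ (hΦt.memLp_two_heatDuhamelBack hν 0)).trans
      (mul_le_mul_of_nonneg_left hU0 (Real.sqrt_nonneg _))
  -- the gradient field `A = DU` on the slab
  set A : ℝ × E → E →L[ℝ] E := fun p => fderiv ℝ (U p.1) p.2 with hA_def
  have hUs : ContDiff ℝ ∞ (uncurry U) := hΦt.contDiff_uncurry_heatDuhamelBack_infty hν
  have hAm : AEStronglyMeasurable A μ := (contDiff_uncurry_fderiv_slice hUs).continuous.aestronglyMeasurable
  obtain ⟨hSint, hSeq⟩ := hΦt.integral_sum_sq_norm_fderiv_heatDuhamelBack_slab hν hT.le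
  have hAS : ∀ p, ‖A p‖ ^ 2 ≤ ∑ i, ‖fderiv ℝ (U p.1) p.2 (bE i)‖ ^ 2 := fun p => by
    have h := opNorm_le_sqrt_sum_sq bE (A p)
    calc ‖A p‖ ^ 2 ≤ (Real.sqrt (∑ i, ‖A p (bE i)‖ ^ 2)) ^ 2 := by gcongr
      _ = ∑ i, ‖fderiv ℝ (U p.1) p.2 (bE i)‖ ^ 2 := Real.sq_sqrt (Finset.sum_nonneg fun _ _ => by positivity)
  have hA2i : Integrable (fun p => ‖A p‖ ^ 2) μ :=
    hSint.mono' (hAm.norm.pow 2) (Eventually.of_forall fun p => by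
      rw [Real.norm_of_nonneg (by positivity)]; exact hAS p)
  have hA2 : MemLp A 2 μ := (memLp_two_iff_integrable_sq_norm hAm).2 hA2i
  have hAint : ∫ p, ‖A p‖ ^ 2 ∂μ ≤ 2 * N ^ 2 / ν := by
    calc ∫ p, ‖A p‖ ^ 2 ∂μ ≤ ∫ p, ∑ i, ‖fderiv ℝ (U p.1) p.2 (bE i)‖ ^ 2 ∂μ :=
          integral_mono_of_nonneg (Eventually.of_forall fun _ => by positivity) hSint
            (Eventually.of_forall hAS)
      _ = ∫ s in (0 : ℝ)..T, ∑ i, ∫ x, ‖fderiv ℝ (U s) x (bE i)‖ ^ 2 := hSeq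
      _ ≤ 2 * N ^ 2 / ν := by
          rw [le_div_iff₀ hν, mul_comm]
          exact hP2
  have hI₂ : |∫ p, ⟪v p.1 p.2, fderiv ℝ (U p.1) p.2 (v p.1 p.2)⟫ ∂μ| ≤
      Real.sqrt (∫ p, ‖v p.1 p.2‖ ^ 4 ∂μ) * (Real.sqrt (2 / ν) * N) := by
    have h := abs_integral_inner_clm_apply_le (V := uncurry v) hV4 hA2
    refine h.trans (mul_le_mul_of_nonneg_left ?_ (Real.sqrt_nonneg _))
    calc Real.sqrt (∫ p, ‖A p‖ ^ 2 ∂μ) ≤ Real.sqrt (2 * N ^ 2 / ν) := Real.sqrt_le_sqrt hAint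
      _ = Real.sqrt (2 / ν) * N := by
          rw [show 2 * N ^ 2 / ν = (2 / ν) * N ^ 2 by ring, Real.sqrt_mul (by positivity),
            Real.sqrt_sq hN0]
  -- conclusion
  calc |(∫ p, ⟪v p.1 p.2, fderiv ℝ (U p.1) p.2 (v p.1 p.2)⟫ ∂μ) + ∫ x, ⟪v₀ x, U 0 x⟫|
      ≤ |∫ p, ⟪v p.1 p.2, fderiv ℝ (U p.1) p.2 (v p.1 p.2)⟫ ∂μ| + |∫ x, ⟪v₀ x, U 0 x⟫| := abs_add_le _ _
    _ ≤ Real.sqrt (∫ p, ‖v p.1 p.2‖ ^ 4 ∂μ) * (Real.sqrt (2 / ν) * N) +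
          Real.sqrt (∫ x, ‖v₀ x‖ ^ 2) * (2 * N) := add_le_add hI₂ hI₀
    _ = (Real.sqrt (2 / ν) * Real.sqrt (∫ p, ‖v p.1 p.2‖ ^ 4 ∂μ) +
          2 * Real.sqrt (∫ x, ‖v₀ x‖ ^ 2)) * N := by ring

/-- **The `L¹ₜ L²ₓ` duality bound** (the estimate behind `v ∈ L^∞(0,T; L²)` in Galdi 2019,
Thm. 1.1; here via the heat adjoint). In the setting of the vorticity-duality identity
(`IsWeakNSSolutionOn.integral_inner_curlPair_eq`), with `Φ = (∂ₐθ) c - (∂_cθ) a`: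
`|∫_{(0,T)×E} ⟪v, Φ⟫| ≤ (√(2/ν) ‖v‖²_{L⁴(Q_T)} + 2 ‖v₀‖_{L²}) ∫₀ᵀ ‖Φ(s)‖_{L²} ds`. [cite: Galdi2018, proof of Thm. 1.1, (2.12)–(2.13)] -/
theorem IsWeakNSSolutionOn.abs_integral_inner_curlPair_le_L1 (hν : 0 < ν) (hT : 0 < T)
    (hw : IsWeakNSSolutionOn T ν 0 v₀ v) (hv₀ : MemLp v₀ 2 volume)
    (hv4 : eLpNorm (uncurry v) 4 ((volume.restrict (Ioo 0 T)).prod (volume : Measure E)) < ⊤)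
    (hθ : IsSpaceTimeTestOn (⊤ : Opens (ℝ × E)) θ) {b : ℝ} (hbT : b < T)
    (hb : ∀ t, b ≤ t → θ t = 0) (a c : E) {Φ : ℝ → E → E}
    (hΦ : ∀ t x, Φ t x = (fderiv ℝ (θ t) x a) • c - (fderiv ℝ (θ t) x c) • a) :
    |∫ p, ⟪v p.1 p.2, Φ p.1 p.2⟫ ∂((volume.restrict (Ioo 0 T)).prod (volume : Measure E))| ≤
      (Real.sqrt (2 / ν) * Real.sqrt (∫ p, ‖v p.1 p.2‖ ^ 4
          ∂((volume.restrict (Ioo 0 T)).prod (volume : Measure E))) +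
        2 * Real.sqrt (∫ x, ‖v₀ x‖ ^ 2)) *
        ∫ s in (0 : ℝ)..T, Real.sqrt (∫ x, ‖Φ s x‖ ^ 2) := by
  have hid := hw.integral_inner_curlPair_eq hν hv₀ hv4 hθ hbT hb a c hΦ
  obtain rfl : Φ = fun t x => 𝐋[a, c] (fderiv ℝ (θ t) x) := by
    funext t x; rw [hΦ]; simp
  have hΦt : IsSpaceTimeTestOn (⊤ : Opens (ℝ × E)) (fun t x => 𝐋[a, c] (fderiv ℝ (θ t) x)) :=
    hθ.fderiv_top.clm_apply_top 𝐋[a, c]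
  have hbΦ : ∀ t, b ≤ t → (fun x => 𝐋[a, c] (fderiv ℝ (θ t) x)) = 0 := fun t ht => by
    funext x
    rw [Pi.zero_apply, show fderiv ℝ (θ t) x = 0 from congrFun (fderiv_slice_eq_zero_of_eq_zero (hb t ht)) x,
      map_zero]
  exact abs_integral_inner_le_L1_of_duality hν hT (aestronglyMeasurable_uncurry_prod_of_restrict hw.1)
    hv₀ hv4 hΦt hbT.le hbΦ hid

/-- **The `L²(Q_T)` duality bound** (the estimate behind `∇v ∈ L²(Q_T)` in Galdi 2019, Thm. 1.1;
here via heat maximal regularity). In the setting of the vorticity-duality identity, with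
`Φ = (∂ₐθ) c - (∂_cθ) a` and `n = dim E`:
`|∫_{(0,T)×E} ⟪v, Φ⟫| ≤ 2‖a‖‖c‖ ((√n/ν) ‖v‖²_{L⁴(Q_T)} + √(2n/ν) ‖v₀‖_{L²}) ‖θ‖_{L²(Q_T)}`.
Proof: `U = (∂ₐ𝒰[θ]) c - (∂_c𝒰[θ]) a`, so `‖∇U‖ ≤ 2‖a‖‖c‖ ‖D²𝒰[θ]‖` and
`‖U(0)‖ ≤ 2‖a‖‖c‖ ‖D𝒰[θ](0)‖` pointwise; then `‖D²𝒰[θ]‖²_{L²(Q_T)} ≤ (n/ν²)‖θ‖²_{L²(Q_T)}`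
(maximal regularity) and `‖D𝒰[θ](0)‖₂² ≤ (2n/ν)‖θ‖²_{L²(Q_T)}`. [cite: Galdi2018, proof of Thm. 1.1, (2.12)–(2.13)] -/
theorem IsWeakNSSolutionOn.abs_integral_inner_curlPair_le_L2 (hν : 0 < ν) (hT : 0 < T)
    (hw : IsWeakNSSolutionOn T ν 0 v₀ v) (hv₀ : MemLp v₀ 2 volume)
    (hv4 : eLpNorm (uncurry v) 4 ((volume.restrict (Ioo 0 T)).prod (volume : Measure E)) < ⊤)
    (hθ : IsSpaceTimeTestOn (⊤ : Opens (ℝ × E)) θ) {b : ℝ} (hbT : b < T)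
    (hb : ∀ t, b ≤ t → θ t = 0) (a c : E) {Φ : ℝ → E → E}
    (hΦ : ∀ t x, Φ t x = (fderiv ℝ (θ t) x a) • c - (fderiv ℝ (θ t) x c) • a) :
    |∫ p, ⟪v p.1 p.2, Φ p.1 p.2⟫ ∂((volume.restrict (Ioo 0 T)).prod (volume : Measure E))| ≤
      2 * ‖a‖ * ‖c‖ * (Real.sqrt (Module.finrank ℝ E) / ν * Real.sqrt (∫ p, ‖v p.1 p.2‖ ^ 4
          ∂((volume.restrict (Ioo 0 T)).prod (volume : Measure E))) +
        Real.sqrt (2 * Module.finrank ℝ E / ν) * Real.sqrt (∫ x, ‖v₀ x‖ ^ 2)) *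
        Real.sqrt (∫ p, ‖θ p.1 p.2‖ ^ 2 ∂((volume.restrict (Ioo 0 T)).prod (volume : Measure E))) := by
  rw [hw.integral_inner_curlPair_eq hν hv₀ hv4 hθ hbT hb a c hΦ]
  obtain rfl : Φ = fun t x => 𝐋[a, c] (fderiv ℝ (θ t) x) := by
    funext t x; rw [hΦ]; simp
  set bE := stdOrthonormalBasis ℝ E
  set n : ℝ := (Module.finrank ℝ E : ℝ) with hn
  set μ : Measure (ℝ × E) := (volume.restrict (Ioo 0 T)).prod (volume : Measure E) with hμ
  have hθ₁ : IsSpaceTimeTestOn (⊤ : Opens (ℝ × E)) (fun t x => fderiv ℝ (θ t) x) := hθ.fderiv_top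
  have hΦt : IsSpaceTimeTestOn (⊤ : Opens (ℝ × E)) (fun t x => 𝐋[a, c] (fderiv ℝ (θ t) x)) :=
    hθ₁.clm_apply_top 𝐋[a, c]
  obtain ⟨a₀, hab⟩ := hθ.exists_time_support_of_le hb
  set U : ℝ → E → E := heatDuhamelBack ν (fun t x => 𝐋[a, c] (fderiv ℝ (θ t) x)) with hU_def
  set W : ℝ → E → ℝ := heatDuhamelBack ν θ with hW_def
  set Q : ℝ := ∫ s in (0 : ℝ)..T, ∫ x, ‖θ s x‖ ^ 2 with hQ
  have hQμ : ∫ p, ‖θ p.1 p.2‖ ^ 2 ∂μ = Q := hθ.integral_sq_norm_slab hT.le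
  have hQ0 : 0 ≤ Q := by rw [← hQμ]; exact integral_nonneg fun _ => by positivity
  set K : ℝ := 2 * ‖a‖ * ‖c‖ with hK
  have hK0 : 0 ≤ K := by positivity
  -- `U(t) = 𝐋 ∘ D(W t)`
  have hUfun : ∀ t, U t = fun x => 𝐋[a, c] (fderiv ℝ (W t) x) := fun t => by
    funext x
    rw [hU_def, hθ₁.heatDuhamelBack_clm_apply hν 𝐋[a, c] t x, hW_def, hθ.fderiv_heatDuhamelBack hν t]
  have hWs : ∀ t, ContDiff ℝ ∞ (W t) := fun t =>
    contDiff_slice_of_contDiff_uncurry (hθ.contDiff_uncurry_heatDuhamelBack_infty hν) t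
  -- ### the datum term: `‖U 0‖₂ ≤ K √(2n/ν) √Q`
  have hV4 : MemLp (uncurry v) 4 μ := ⟨aestronglyMeasurable_uncurry_prod_of_restrict hw.1, hv4⟩
  have hY := hθ.sum_integral_sq_norm_fderiv_heatDuhamelBack_zero_le hν hab hT.le hbT.le
  have hθi : ∀ i, IsSpaceTimeTestOn (⊤ : Opens (ℝ × E)) (fun t y => fderiv ℝ (θ t) y (bE i)) :=
    fun i => hθ.fderiv_apply_top (bE i)
  have iYi : ∀ i, Integrable (fun x => ‖fderiv ℝ (W 0) x (bE i)‖ ^ 2) volume := fun i => by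
    have hm := (hθi i).memLp_two_heatDuhamelBack hν 0
    have h := (memLp_two_iff_integrable_sq_norm hm.1).1 hm
    refine h.congr (Eventually.of_forall fun x => ?_)
    dsimp only
    rw [hW_def, hθ.fderiv_heatDuhamelBack_apply hν 0 x (bE i)]
  have hU0sq : ∫ x, ‖U 0 x‖ ^ 2 ≤ K ^ 2 * (2 * n / ν * Q) := by
    have hpt : ∀ x, ‖U 0 x‖ ^ 2 ≤ K ^ 2 * ∑ i, ‖fderiv ℝ (W 0) x (bE i)‖ ^ 2 := fun x => by
      rw [hUfun 0]
      have h1 : ‖𝐋[a, c] (fderiv ℝ (W 0) x)‖ ≤ K * ‖fderiv ℝ (W 0) x‖ := norm_curlPairCLM_apply_le a c _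
      have h2 : ‖fderiv ℝ (W 0) x‖ ≤ Real.sqrt (∑ i, ‖fderiv ℝ (W 0) x (bE i)‖ ^ 2) :=
        opNorm_le_sqrt_sum_sq bE _
      calc ‖𝐋[a, c] (fderiv ℝ (W 0) x)‖ ^ 2 ≤ (K * ‖fderiv ℝ (W 0) x‖) ^ 2 := by gcongr
        _ ≤ (K * Real.sqrt (∑ i, ‖fderiv ℝ (W 0) x (bE i)‖ ^ 2)) ^ 2 := by gcongr
        _ = K ^ 2 * ∑ i, ‖fderiv ℝ (W 0) x (bE i)‖ ^ 2 := by
            rw [mul_pow, Real.sq_sqrt (Finset.sum_nonneg fun _ _ => by positivity)]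
    have isum : Integrable (fun x => K ^ 2 * ∑ i, ‖fderiv ℝ (W 0) x (bE i)‖ ^ 2) volume :=
      (integrable_finsetSum _ fun i _ => iYi i).const_mul _
    calc ∫ x, ‖U 0 x‖ ^ 2 ≤ ∫ x, K ^ 2 * ∑ i, ‖fderiv ℝ (W 0) x (bE i)‖ ^ 2 :=
          integral_mono_of_nonneg (Eventually.of_forall fun _ => by positivity) isum (Eventually.of_forall hpt)
      _ = K ^ 2 * ∑ i, ∫ x, ‖fderiv ℝ (W 0) x (bE i)‖ ^ 2 := by
          rw [integral_const_mul, integral_finsetSum _ fun i _ => iYi i]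
      _ ≤ K ^ 2 * (2 * n / ν * Q) := mul_le_mul_of_nonneg_left hY (by positivity)
  have hU0 : Real.sqrt (∫ x, ‖U 0 x‖ ^ 2) ≤ K * (Real.sqrt (2 * n / ν) * Real.sqrt Q) := by
    calc Real.sqrt (∫ x, ‖U 0 x‖ ^ 2) ≤ Real.sqrt (K ^ 2 * (2 * n / ν * Q)) := Real.sqrt_le_sqrt hU0sq
      _ = K * (Real.sqrt (2 * n / ν) * Real.sqrt Q) := by
          rw [Real.sqrt_mul (by positivity), Real.sqrt_sq hK0, Real.sqrt_mul (by positivity)]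
  have hI₀ : |∫ x, ⟪v₀ x, U 0 x⟫| ≤ Real.sqrt (∫ x, ‖v₀ x‖ ^ 2) * (K * (Real.sqrt (2 * n / ν) * Real.sqrt Q)) :=
    (abs_integral_inner_le_sqrt_mul_sqrt' hv₀ (hΦt.memLp_two_heatDuhamelBack hν 0)).trans
      (mul_le_mul_of_nonneg_left hU0 (Real.sqrt_nonneg _))
  -- ### the gradient field `A = DU`: `‖A‖²_{L²(μ)} ≤ K² n Q / ν²`
  set A : ℝ × E → E →L[ℝ] E := fun p => fderiv ℝ (U p.1) p.2 with hA_def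
  have hUs : ContDiff ℝ ∞ (uncurry U) := hΦt.contDiff_uncurry_heatDuhamelBack_infty hν
  have hAm : AEStronglyMeasurable A μ := (contDiff_uncurry_fderiv_slice hUs).continuous.aestronglyMeasurable
  obtain ⟨hSint, hSeq⟩ := hθ.integral_sum_sum_sq_norm_fderiv_fderiv_heatDuhamelBack_slab hν hT.le
  have hX := hθ.energy_estimate_one hν hab hT.le hbT.le
  have hAS : ∀ p : ℝ × E, ‖A p‖ ^ 2 ≤ K ^ 2 * ∑ i, ∑ j,
      ‖fderiv ℝ (fun y => fderiv ℝ (W p.1) y (bE i)) p.2 (bE j)‖ ^ 2 := fun p => by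
    have h1 : ‖A p‖ ≤ K * ‖iteratedFDeriv ℝ 2 (W p.1) p.2‖ := by
      rw [hA_def]; dsimp only; rw [hUfun p.1]
      exact norm_fderiv_curlPair_le (hWs p.1) p.2
    have h2 : ‖iteratedFDeriv ℝ 2 (W p.1) p.2‖ ^ 2 ≤ ∑ i, ∑ j,
        ‖fderiv ℝ (fun y => fderiv ℝ (W p.1) y (bE i)) p.2 (bE j)‖ ^ 2 := by
      rw [← norm_iteratedFDeriv_fderiv, norm_iteratedFDeriv_one]
      exact norm_fderiv_fderiv_sq_le_sum_sum p.2
    calc ‖A p‖ ^ 2 ≤ (K * ‖iteratedFDeriv ℝ 2 (W p.1) p.2‖) ^ 2 := by gcongr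
      _ = K ^ 2 * ‖iteratedFDeriv ℝ 2 (W p.1) p.2‖ ^ 2 := by ring
      _ ≤ K ^ 2 * ∑ i, ∑ j, ‖fderiv ℝ (fun y => fderiv ℝ (W p.1) y (bE i)) p.2 (bE j)‖ ^ 2 := by gcongr
  have hA2i : Integrable (fun p => ‖A p‖ ^ 2) μ :=
    (hSint.const_mul (K ^ 2)).mono' (hAm.norm.pow 2) (Eventually.of_forall fun p => by
      rw [Real.norm_of_nonneg (by positivity)]; exact hAS p)
  have hA2 : MemLp A 2 μ := (memLp_two_iff_integrable_sq_norm hAm).2 hA2i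
  have hAint : ∫ p, ‖A p‖ ^ 2 ∂μ ≤ K ^ 2 * (n / ν ^ 2 * Q) := by
    calc ∫ p, ‖A p‖ ^ 2 ∂μ ≤ ∫ p, K ^ 2 * ∑ i, ∑ j,
          ‖fderiv ℝ (fun y => fderiv ℝ (W p.1) y (bE i)) p.2 (bE j)‖ ^ 2 ∂μ :=
          integral_mono_of_nonneg (Eventually.of_forall fun _ => by positivity) (hSint.const_mul _)
            (Eventually.of_forall hAS)
      _ = K ^ 2 * ∫ s in (0 : ℝ)..T, ∑ i, ∑ j, ∫ x,
          ‖fderiv ℝ (fun y => fderiv ℝ (W s) y (bE i)) x (bE j)‖ ^ 2 := by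
          rw [integral_const_mul, hSeq]
      _ ≤ K ^ 2 * (n / ν ^ 2 * Q) := mul_le_mul_of_nonneg_left hX (by positivity)
  have hI₂ : |∫ p, ⟪v p.1 p.2, fderiv ℝ (U p.1) p.2 (v p.1 p.2)⟫ ∂μ| ≤
      Real.sqrt (∫ p, ‖v p.1 p.2‖ ^ 4 ∂μ) * (K * (Real.sqrt n / ν * Real.sqrt Q)) := by
    have h := abs_integral_inner_clm_apply_le (V := uncurry v) hV4 hA2
    refine h.trans (mul_le_mul_of_nonneg_left ?_ (Real.sqrt_nonneg _))
    calc Real.sqrt (∫ p, ‖A p‖ ^ 2 ∂μ) ≤ Real.sqrt (K ^ 2 * (n / ν ^ 2 * Q)) := Real.sqrt_le_sqrt hAint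
      _ = K * (Real.sqrt n / ν * Real.sqrt Q) := by
          rw [Real.sqrt_mul (by positivity), Real.sqrt_sq hK0, Real.sqrt_mul (by positivity),
            Real.sqrt_div' _ (by positivity), Real.sqrt_sq hν.le]
  -- ### conclusion
  rw [hQμ]
  calc |(∫ p, ⟪v p.1 p.2, fderiv ℝ (U p.1) p.2 (v p.1 p.2)⟫ ∂μ) + ∫ x, ⟪v₀ x, U 0 x⟫|
      ≤ |∫ p, ⟪v p.1 p.2, fderiv ℝ (U p.1) p.2 (v p.1 p.2)⟫ ∂μ| + |∫ x, ⟪v₀ x, U 0 x⟫| := abs_add_le _ _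
    _ ≤ Real.sqrt (∫ p, ‖v p.1 p.2‖ ^ 4 ∂μ) * (K * (Real.sqrt n / ν * Real.sqrt Q)) +
          Real.sqrt (∫ x, ‖v₀ x‖ ^ 2) * (K * (Real.sqrt (2 * n / ν) * Real.sqrt Q)) := add_le_add hI₂ hI₀
    _ = K * (Real.sqrt n / ν * Real.sqrt (∫ p, ‖v p.1 p.2‖ ^ 4 ∂μ) +
          Real.sqrt (2 * n / ν) * Real.sqrt (∫ x, ‖v₀ x‖ ^ 2)) * Real.sqrt Q := by ring

end Bounds



end Literature.Analysis.FluidPDE
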